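import Literature.Barriers.AnomalousDissipation.ConvexIntegrationNonLeray
import Literature.Analysis.FluidPDE.NavierStokesReynolds
import Literature.Analysis.FluidPDE.OnsagerBDSV
import Literature.Analysis.FunctionSpaces.TorusSobolevNormFacts
import Literature.Analysis.FunctionSpaces.TorusSobolevNormProofs
import HarnessLib

/-!
# Buckmaster–Vicol 2019, Thm. 1.3 — proof architecture: the printed sub-results as named
  facts, and the proved assembly

Sibling proof file of the barrier entry
`Literature/Barriers/AnomalousDissipation/ConvexIntegrationNonLeray` (D-0021), working towards
the named fact `BuckmasterVicol2019_thm13` (Buckmaster–Vicol, Ann. of Math. 189 (2019), Thm. 1.3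
= EMS Surv. 6 (2020), Thm. 3.10: every zero-mean weak Euler solution `u ∈ C^{β̄}_{t,x}` on
`[-2T,2T]` is the strong `C⁰_t L²_x` limit, as `ν_n → 0`, of weak Navier–Stokes solutions
uniformly bounded in `C⁰_t H^β_x`). The printed proof (§2.5, p. 6 of the held arXiv text
1709.10033) is half a page resting on the iterative Prop. 2.1 (p. 5; its proof is §§3–6,
pp. 7–21: intermittent Beltrami flows, `L^p` decorrelation, the perturbation with its
incompressibility and temporal correctors, inverse-divergence and commutator estimates for the
new Reynolds stress, the energy iterate) run "as in the proof of Theorem 1.2" (§2.4, pp. 5–6: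
interpolation (2.9), limit (2.10)), started from a space–time mollification of `u`
((2.12)–(2.15)). This file vendors the two halves as named facts and proves the half page:

* `BV2019.freq`, `BV2019.amp` — the parameters `λ_q = a^{(b^q)}`, `δ_q = λ_1^{3β} λ_q^{-2β}` (§2.1);
  `BV2019.TimeDerivSupLE`, `BV2019.C1xtLE`, `BV2019.L1LE` — the norms of the inductive estimates
  (2.3)–(2.5) as bound predicates on `[0,T] × T³` (footnote 1 of §2.2), built on the accepted
  `BDSV.SupLE`, `BDSV.DerivSupLE` (`FluidPDE/OnsagerBDSV`); classical
  Navier–Stokes–Reynolds triples are the accepted `Torus.IsNSReynoldsOn`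
  (`FluidPDE/NavierStokesReynolds`, BV19 (2.1)).
* `BuckmasterVicol2019_iterationFromLevel` — **Prop. 2.1 iterated from level `n`, with the limit
  of §2.4, exactly as invoked in §2.5** ("At this stage we may start the inductive Proposition 2.1,
  and as in the proof of Theorem 1.2, we obtain a weak solution … such that
  `‖v^{(ν_n)} - v_n‖_{H^{β'}} ≤ …`"): named fact, the XL core.
* `BuckmasterVicol2019_mollifiedEulerStart` — **§2.5, (2.12)–(2.15)**: the space–time mollification
  of `u` at scale `λ^{-1}` is a classical Navier–Stokes–Reynolds triple for every viscosity
  `ν ≤ λ^{-1}` with the printed sup-norm bounds, `H^{β'}`-close to `u`: named fact (size L: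
  mollification, the mollified Euler equation and its pressure, the Constantin–E–Titi commutator
  estimate, `C^{β''} ⊂ H^{β'}` on `T³`).
* `BuckmasterVicol2019_thm13_of_parts` — **proved**: the two facts imply
  `BuckmasterVicol2019_thm13`. The Lean content of the half page: the choice of the parameters
  `b, β, ε_R, β'` given `β̄` and of `a = a(n)` (`BV2019.tail_le`: the tail of (2.9) is
  `≤ 2K a^{2bβ - γb²}`, `γ = β(1-β') - 4β'`; `BV2019.stress_l1_key`: (2.4) at level `n`;
  `BV2019.c1_budget`: (2.3), (2.5) at level `n`), the triangle inequality in `H^{β'}`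
  (`Torus.eSobolevNorm_add_le_holds`), `‖·‖_{L²} ≤ ‖·‖_{H^{β'}}` (Parseval,
  `Torus.eSobolevNorm_zero_eq_eLpNorm_holds`), extension by zero off `[0,T]`, and the two limits
  `ν_n = λ_n^{-1} ≤ 1/n → 0`, `sup_t ‖v^{(ν_n)}(t) - u(t)‖_{L²} ≤ 1/n → 0`.

## Reading of the printed proof (where the facts follow the proof rather than the wording)

All benign, recorded so that the facts can be attacked and discharged:
(1) Prop. 2.1 lets `a₀` depend on `M_e = ‖e‖_{C¹_t}`, while in §2.5 the profile
`e = ∫|v_n|² + δ/2` depends on `a` and `n`; `M_e` is used only in Lemma 6.1 (6.1) (p. 20: "we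
crudely use a factor of `λ_q` to absorb constants … (6.1) follows immediately from the assumed
estimate `‖e‖_{C¹_t} ≤ M_e`"), through `2ℓ M_e ≲ ℓ^{1/2}`, `ℓ = λ_q^{-20}` ((4.16), p. 11), which
holds at all levels `q ≥ n` since `M_e ≤ 2λ_n⁸` by (2.3); the iteration fact therefore carries no
profile. (2) §2.5 prints `e(t) = ∫|v_n|² + δ_n/2`; (2.6) at level `n` needs `δ_{n+1}/2`.
(3) (2.4) at level `n`, `λ_n^{-2β̄} ≲ λ_n^{-ε_R} δ_{n+1}`, forces `2βb + ε_R < 2β̄` up to constants: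
the parameters `β`, `ε_R` of Prop. 2.1 must be re-chosen small given `β̄` ("there exists
`β > 0`" in Thm. 1.3 depends on `β̄`); Prop. 2.1 is stated for all admissible `β` and all
sufficiently small `ε_R`, as its wording ("sufficiently small parameter `ε_R(b, β)`") allows.
(4) §2.5 sets `ν_n := λ_n^{-1}` but writes the dissipative part of the stress with `λ_n^{-2}`;
with `ν ≤ λ^{-1}` that part is `O(λ^{-β̄})` in `C⁰`, which is what the start fact records (for
`β̄ ≤ 1`; the assembly lowers `β̄` to `β̄ ∧ 1`, `holderOnSpaceTime_of_le`). (5) (2.15) and the last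
display use `‖f‖_{H^{β'}} ≤ |T³|^{1/2} ‖f‖_{C^{β'}}`, true for `C^{β''}`, `β'' > β'`; the start fact
records the qualitative consequence (`H^{β'}`-closeness for `λ` large, `β' < β̄/2`). (6) For (2.11)
the prefactor `λ_1^{3β(1-β')/2}` of (2.9) must be beaten by `λ_{n+1}^{-γ}` already at `n = 1`; the
assembly takes `β' ≤ β/32`, for which `γ ≥ 5β/8` and `γ b² > 2bβ`.

## References

* T. Buckmaster, V. Vicol, *Nonuniqueness of weak solutions to the Navier–Stokes equation*,
  Ann. of Math. 189 (2019), 101–144; arXiv:1709.10033: Def. 1.1, Thm. 1.3 (p. 4), §2.1–§2.3 and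
  Prop. 2.1 (p. 5), §2.4 (2.9)–(2.10) (pp. 5–6), §2.5 (2.11)–(2.15) (p. 6), (4.16) (p. 11),
  Lemma 6.1 (p. 20). [`BuckmasterVicol2019Annals`]
* T. Buckmaster, V. Vicol, *Convex integration and phenomenologies in turbulence*, EMS Surv.
  Math. Sci. 6 (2020), Thm. 3.10 (p. 14 of arXiv:1901.09023). [`BuckmasterVicol2020`]
* P. Constantin, W. E, E. S. Titi, Comm. Math. Phys. 165 (1994), 207–209 (commutator estimate);
  S. Conti, C. De Lellis, L. Székelyhidi Jr., in *Nonlinear PDE*, Abel Symp. 7 (2012), Lemma 1.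
-/

open MeasureTheory Set Filter Topology
open scoped ENNReal NNReal InnerProductSpace

noncomputable section

namespace Literature.Barriers.AnomalousDissipation

open Literature.Analysis.FunctionSpaces Literature.Analysis.FluidPDE

/-- The flat three-torus `T³ = (ℝ/ℤ)³` (local notation). -/
local notation "𝕋³" => UnitAddTorus (Fin 3)
/-- Velocity values (local notation). -/
local notation "ℝ³" => EuclideanSpace ℝ (Fin 3)

/-! ## The vocabulary of the scheme (BV19 §2.1–§2.3) -/

namespace BV2019

/-- The frequency parameter `λ_q = a^{(b^q)}` of the Buckmaster–Vicol scheme (§2.1, (2.2)), an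
integer since `a ∈ ℕ` ("some integer `a ≫ 1`") and `b ∈ 16ℕ`. [cite: BuckmasterVicol2019Annals, §2.1 (2.2)] -/
def freq (a b q : ℕ) : ℕ :=
  a ^ b ^ q

/-- The amplitude parameter `δ_q = λ_1^{3β} λ_q^{-2β}` of the Buckmaster–Vicol scheme
(§2.1, (2.2)). [cite: BuckmasterVicol2019Annals, §2.1 (2.2)] -/
def amp (β : ℝ) (a b q : ℕ) : ℝ :=
  (freq a b 1 : ℝ) ^ (3 * β) * (freq a b q : ℝ) ^ (-2 * β)

/-- Unfolding of `λ_q`. [folklore] -/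
theorem freq_eq (a b q : ℕ) : freq a b q = a ^ b ^ q := rfl

/-- `λ_q ≥ 1` for `a ≥ 1`. [folklore] -/
theorem one_le_freq {a : ℕ} (ha : 1 ≤ a) (b q : ℕ) : 1 ≤ freq a b q :=
  Nat.one_le_pow _ _ ha

/-- `(λ_q : ℝ) ≥ 1` for `a ≥ 1`. [folklore] -/
theorem one_le_freq_real {a : ℕ} (ha : 1 ≤ a) (b q : ℕ) : (1 : ℝ) ≤ (freq a b q : ℝ) := by
  exact_mod_cast one_le_freq ha b q

/-- `(λ_q : ℝ) > 0` for `a ≥ 1`. [folklore] -/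
theorem freq_real_pos {a : ℕ} (ha : 1 ≤ a) (b q : ℕ) : (0 : ℝ) < (freq a b q : ℝ) :=
  lt_of_lt_of_le one_pos (one_le_freq_real ha b q)

/-- `δ_q > 0` for `a ≥ 1`. [folklore] -/
theorem amp_pos (β : ℝ) {a : ℕ} (ha : 1 ≤ a) (b q : ℕ) : 0 < amp β a b q :=
  mul_pos (Real.rpow_pos_of_pos (freq_real_pos ha b 1) _)
    (Real.rpow_pos_of_pos (freq_real_pos ha b q) _)

variable {F : Type*} [NormedAddCommGroup F]

/-- `‖∂ₜ f‖_{L^∞} ≤ B` on `[0,T] × T³`, with the one-sided time derivative within `[0,T]`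
(`Torus.timeDerivWithin (Icc 0 T)`, the convention of `Torus.IsNSReynoldsOn`). [cite: BuckmasterVicol2019Annals, §2.2 footnote 1] -/
def TimeDerivSupLE [NormedSpace ℝ F] (T : ℝ) (f : ℝ → 𝕋³ → F) (B : ℝ) : Prop :=
  ∀ t ∈ Icc 0 T, ∀ x, ‖Torus.timeDerivWithin (Icc 0 T) f t x‖ ≤ B

/-- `‖f‖_{C¹_{x,t}} ≤ B` in the notation of BV19 (footnote 1 of §2.2:
"`‖f‖_{C^N_{x,t}} = ∑_{0 ≤ n+|α| ≤ N} ‖∂ₜⁿ D^α f‖_{L^∞}`", `L^∞ = L^∞_t L^∞_x` on `[0,T] × T³`), i.e.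
`‖f‖_{L^∞} + ∑ᵢ ‖∂ᵢ f‖_{L^∞} + ‖∂ₜ f‖_{L^∞} ≤ B`, rendered through bounds `B₀`, `B₁ i`, `B₂` of the five
sup norms (`BDSV.SupLE` of `FluidPDE/OnsagerBDSV`: `∀ t ∈ [0,T], ∀ x, ‖f t x‖ ≤ B`) with
`B₀ + ∑ᵢ B₁ i + B₂ ≤ B` (equivalent, taking the `B`'s to be the sup norms). [cite: BuckmasterVicol2019Annals, §2.2 footnote 1] -/
def C1xtLE [NormedSpace ℝ F] (T : ℝ) (f : ℝ → 𝕋³ → F) (B : ℝ) : Prop :=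
  ∃ (B₀ B₂ : ℝ) (B₁ : Fin 3 → ℝ), BDSV.SupLE T f B₀ ∧
    (∀ i, BDSV.SupLE T (fun t => Torus.partialDeriv i (f t)) (B₁ i)) ∧
    TimeDerivSupLE T f B₂ ∧ B₀ + ∑ i, B₁ i + B₂ ≤ B

/-- `‖R‖_{L¹} = ‖R‖_{L^∞_t L¹_x} ≤ B` on `[0,T]` (BV19 footnote 1 of §2.2), for a stress stored by
columns (`R t x j ∈ ℝ³`, pointwise norm the maximal column norm, as in `Torus.IsNSReynoldsOn`). [cite: BuckmasterVicol2019Annals, §2.2 footnote 1] -/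
def L1LE (T : ℝ) (R : ℝ → 𝕋³ → F) (B : ℝ) : Prop :=
  ∀ t ∈ Icc 0 T, ∫ x, ‖R t x‖ ≤ B

variable {T : ℝ} {f : ℝ → 𝕋³ → F} {B B' : ℝ}

/-- Monotonicity of `‖f‖_{C¹_{x,t}} ≤ B` in `B`. [folklore] -/
theorem C1xtLE.mono [NormedSpace ℝ F] (h : C1xtLE T f B) (hB : B ≤ B') : C1xtLE T f B' := by
  obtain ⟨B₀, B₂, B₁, h0, h1, h2, hs⟩ := h
  exact ⟨B₀, B₂, B₁, h0, h1, h2, hs.trans hB⟩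

/-- Monotonicity of `‖f‖_{L¹} ≤ B` in `B`. [folklore] -/
theorem L1LE.mono (h : L1LE T f B) (hB : B ≤ B') : L1LE T f B' :=
  fun t ht => (h t ht).trans hB

/-- A pointwise bound is an `L¹` bound on the probability space `T³`. [folklore] -/
theorem l1LE_of_supLE (h : BDSV.SupLE T f B) : L1LE T f B := by
  intro t ht
  have hB : ∀ x, ‖f t x‖ ≤ B := h t ht
  calc ∫ x, ‖f t x‖ ≤ ∫ _ : 𝕋³, B := by
          by_cases hi : Integrable (fun x => ‖f t x‖) volume
          · exact integral_mono hi (integrable_const B) hB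
          · rw [integral_undef hi, integral_const, smul_eq_mul]
            simp only [probReal_univ, one_mul]
            exact (norm_nonneg _).trans (hB 0)
    _ = B := by simp

/-- `C¹_{x,t}` control from separate sup bounds. [folklore] -/
theorem c1xtLE_of_bounds [NormedSpace ℝ F] {B₀ B₁ B₂ : ℝ} (h0 : BDSV.SupLE T f B₀)
    (h1 : BDSV.DerivSupLE T f B₁) (h2 : TimeDerivSupLE T f B₂)
    (hB : B₀ + 3 * B₁ + B₂ ≤ B) : C1xtLE T f B :=
  ⟨B₀, B₂, fun _ => B₁, h0, fun i t ht x => h1 i t ht x, h2,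
    by simpa [Finset.sum_const, Finset.card_univ] using hB⟩

end BV2019

/-! ## The printed sub-results, as named facts -/

/-- **Buckmaster–Vicol 2019, the iteration run from level `n` (Prop. 2.1 with §2.4, as invoked in
§2.5), named fact — in the form the printed proof of Thm. 1.3 uses it.**

*Printed.* §2.1: "we fix a sufficiently large, universal constant `b ∈ 16ℕ`, and depending on `b`
we fix a regularity parameter `β > 0` such that `β b² ≤ 4` and `β b ≤ 1/40`"; `λ_q = a^{(b^q)}`,
`δ_q = λ_1^{3β} λ_q^{-2β}` (`BV2019.freq`, `BV2019.amp`). §2.2, inductive estimates on a solution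
`(v_q, p_q, R̊_q)` of the Navier–Stokes–Reynolds system (2.1) on `T³ × [0,T]`:
(2.3) `‖v_q‖_{C¹_{x,t}} ≤ λ_q⁴`, (2.4) `‖R̊_q‖_{L¹} ≤ λ_q^{-ε_R} δ_{q+1}`, (2.5) `‖R̊_q‖_{C¹_{x,t}} ≤ λ_q^{10}`,
and, for an energy profile `e`, (2.6) `0 ≤ e(t) - ∫|v_q|² ≤ δ_{q+1}`, (2.7)
`e(t) - ∫|v_q|² ≤ δ_{q+1}/100 ⇒ R̊_q(·,t) ≡ 0`. Prop. 2.1: "There exists a universal constant `M > 0`, a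
sufficiently small parameter `ε_R = ε_R(b,β) > 0` and a sufficiently large parameter
`a₀ = a₀(b,β,ε_R,M,M_e) > 0` such that for any integer `a ≥ a₀`, which is a multiple of the `N_Λ` of
Remark 3.3, the following holds: Let `(v_q,p_q,R̊_q)` be a triple solving (2.1) in `T³ × [0,T]`
satisfying the inductive estimates (2.3)–(2.7). Then there exists a second triple
`(v_{q+1},p_{q+1},R̊_{q+1})` solving (2.1) and satisfying (2.3)–(2.7) with `q` replaced by `q+1`. In
addition we have that (2.8) `‖v_{q+1} - v_q‖_{L²} ≤ M δ_{q+1}^{1/2}`." §2.4 (proof of Thm. 1.2):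
iterating, "(2.9) `∑_q ‖v_{q+1} - v_q‖_{H^{β'}} ≲ ∑_q ‖v_{q+1} - v_q‖_{L²}^{1-β'} (‖v_{q+1}‖_{C¹} + ‖v_q‖_{C¹})^{β'}
≲ …` for `β' < β/(8+β)` … the implicit constant in (2.9) can be made to be universal … `v = ∑ (v_{q+1} - v_q)`
converges in `C⁰_t H^{β''}_x`, and since `‖R̊_q‖_{L¹} → 0` as `q → ∞`, `v` is a `C⁰_t H^{β''}_x` weak
solution of the Navier–Stokes equation" (weak solutions: Def. 1.1, distributional, mean zero).
§2.5 (proof of Thm. 1.3), having produced a triple obeying (2.3)–(2.5) at level `q = n` with the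
profile `e(t) = ∫|v_n|² + δ/2` "which ensures that (2.6) and (2.7) hold for `q = n`": "At this stage
we may start the inductive Proposition 2.1, and as in the proof of Theorem 1.2, we obtain a weak
solution `v^{(ν_n)}` of the Navier–Stokes equations, with the desired regularity
[`C⁰_t([0,T]; H^{β'}_x)`], such that `‖v^{(ν_n)} - v_n‖_{H^{β'}} ≤` [the tail `q ≥ n` of (2.9)]".

*Transcription* (unit torus `T³ = (ℝ/ℤ)³`, probability Haar measure; equivalent to the printed
`2π`-periodic setting by scaling, the constants being existential): for all sufficiently large
`b ∈ 16ℕ`, all `β > 0` with `β b² ≤ 4`, `β b ≤ 1/40`, all sufficiently small `ε_R > 0`, some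
`N_Λ ≥ 1`, every `T > 0` and every `0 < β' < β/(8+β)` there are `K > 0` (absorbing the universal
implicit constant of (2.9), `M^{1-β'}` and `2^{β'}`) and `a₀` (both may here depend on `T`, `β'` as
well) such that for every integer `a ≥ a₀` divisible by `N_Λ`,
every viscosity `ν ∈ (0,1]` (§1: "`ν ∈ (0,1]`"; the scheme is uniform in it) and every level `n ≥ 1`:
if `(v, p, R)` is a classical solution of the Navier–Stokes–Reynolds system on `[0,T] × T³`
(`Torus.IsNSReynoldsOn (Icc 0 T) ν`, smooth, `R` symmetric trace-free by columns, `p` mean-free)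
with `v` of zero mean, obeying (2.3)–(2.5) at level `n` (`BV2019.C1xtLE`, `BV2019.L1LE`), then
there is a weak solution `w` of Navier–Stokes with viscosity `ν` on `T³ × (0,T)`
(`Torus.IsWeakNSSolutionOn`, the accepted rendering of Def. 1.1) of zero mean on `[0,T]`, in
`C⁰([0,T]; H^{β'})` (`Torus.ContinuousInSobolevOn`, spectral norm of the complexified field), with
`sup_{t ∈ [0,T]} ‖w(t) - v(t)‖_{H^{β'}} ≤ K ∑_{q ≥ n} δ_{q+1}^{(1-β')/2} λ_{q+1}^{4β'}` — the middle
member of (2.9) with (2.8) and (2.3) inserted, summed over `q ≥ n`, in `[0,∞]`.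

*Where the transcription follows the proof rather than the wording* (recorded for the discharge
programme): (i) the energy profile is not a datum here: §2.5 runs Prop. 2.1 with
`e(t) = ∫|v_n(t)|² dx + δ_{n+1}/2` (printed `δ_n/2`, for which (2.6) at level `n` would fail since
`δ_n/2 > δ_{n+1}`), for which (2.6)–(2.7) hold at level `n`; (ii) the dependence `a₀(M_e)`,
`M_e = ‖e‖_{C¹_t}`, cannot be met literally in §2.5 (there `e` depends on `a` and `n`); `M_e` enters
the proof of Prop. 2.1 only through Lemma 6.1 (6.1), `|e(t') - e(t'')| ≤ 2ℓ M_e ≲ ℓ^{1/2}` for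
`|t' - t''| ≤ 2ℓ`, `ℓ = λ_q^{-20}` (4.16), which holds at all levels `q ≥ n` because
`M_e ≤ 2 ‖v_n‖_{C⁰} ‖∂ₜ v_n‖_{C⁰} ≤ 2λ_n⁸` by (2.3). The proof (§§3–6: intermittent Beltrami flows,
`L^p` decorrelation, the perturbation and its correctors, inverse-divergence and commutator
estimates for the new stress, the energy iterate; §2.4: interpolation, `C⁰_t H^{-3}` bounds, limit)
is not formalised. [cite: BuckmasterVicol2019Annals, Prop. 2.1, §2.4 (2.9)–(2.10), §2.5 (2.11)] -/
def BuckmasterVicol2019_iterationFromLevel : Prop :=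
  ∃ b₀ : ℕ, ∀ b : ℕ, b₀ ≤ b → 16 ∣ b →
  ∀ β : ℝ, 0 < β → β * (b : ℝ) ^ 2 ≤ 4 → β * b ≤ 1 / 40 →
  ∃ ε₀ : ℝ, 0 < ε₀ ∧ ∀ εR : ℝ, 0 < εR → εR ≤ ε₀ →
  ∃ NΛ : ℕ, 0 < NΛ ∧
  ∀ T : ℝ, 0 < T → ∀ β' : ℝ, 0 < β' → β' < β / (8 + β) →
  ∃ K : ℝ, 0 < K ∧ ∃ a₀ : ℕ, ∀ a : ℕ, a₀ ≤ a → NΛ ∣ a →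
  ∀ ν : ℝ, 0 < ν → ν ≤ 1 → ∀ n : ℕ, 1 ≤ n →
  ∀ (v : ℝ → 𝕋³ → ℝ³) (p : ℝ → 𝕋³ → ℝ) (R : ℝ → 𝕋³ → Fin 3 → ℝ³),
    Torus.IsNSReynoldsOn (Icc 0 T) ν v p R →
    (∀ t ∈ Icc 0 T, Torus.HasZeroMean (v t)) →
    BV2019.C1xtLE T v ((BV2019.freq a b n : ℝ) ^ 4) →
    BV2019.L1LE T R ((BV2019.freq a b n : ℝ) ^ (-εR) * BV2019.amp β a b (n + 1)) →
    BV2019.C1xtLE T R ((BV2019.freq a b n : ℝ) ^ 10) →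
    ∃ w : ℝ → 𝕋³ → ℝ³,
      Torus.IsWeakNSSolutionOn T ν w ∧
      (∀ t ∈ Icc 0 T, Torus.HasZeroMean (w t)) ∧
      Torus.ContinuousInSobolevOn (Icc 0 T) β' (fun t => EuclideanSpace.complexify ∘ w t) ∧
      ∀ t ∈ Icc 0 T,
        Torus.eSobolevNorm β' (EuclideanSpace.complexify ∘ (w t - v t)) ≤
          ENNReal.ofReal K * ∑' q : ℕ, ENNReal.ofReal
            (BV2019.amp β a b (n + 1 + q) ^ ((1 - β') / 2) *
              (BV2019.freq a b (n + 1 + q) : ℝ) ^ (4 * β'))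

/-- **Buckmaster–Vicol 2019, §2.5: the mollified Euler solution starts the scheme (named fact).**

*Printed* (§2.5, p. 6): for `β̄ > 0` and a weak solution `u ∈ C^{β̄}_{t,x}` of the Euler equations
on `[-2T, 2T]`, `M_u = ‖u‖_{C^{β̄}}`, and `n ≥ 1`, let `φ_ε`, `ϕ_ε` be standard Friedrichs mollifiers
in space and in time and `v_n = (u ∗ₓ φ_{λ_n^{-1}}) ∗ₜ ϕ_{λ_n^{-1}}` restricted to `[0,T]`. "Since `u`
is a solution of the Euler equations, there exists a mean-free `p_n` such that
`∂ₜ v_n + div (v_n ⊗ v_n) + ∇p_n - λ_n^{-2} Δ v_n = div R̊_n`, where `R̊_n` is the traceless symmetric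
part of the tensor `(v_n ⊗ v_n) - ((u ⊗ u) ∗ₓ φ_{λ_n^{-1}}) ∗ₜ ϕ_{λ_n^{-1}} - λ_n^{-2} ∇v_n`. Using a
version of the commutator estimate introduced in [Constantin–E–Titi 1994], which may for instance
be found in [Conti–De Lellis–Székelyhidi 2012], we obtain that (2.12)
`‖R̊_n‖_{L¹} ≲ ‖R̊_n‖_{C⁰} ≲ λ_n^{-1} M_u + λ_n^{-2β̄} M_u²`. In addition, from a similar argument it
follows that (2.13) `‖R̊_n‖_{C¹_{t,x}} ≲ M_u + λ_n^{1-2β̄} M_u²`, (2.14) `‖v_n‖_{C¹_{t,x}} ≲ λ_n^{1-β̄} M_u`.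
Setting `ν := ν_n := λ_n^{-1}` …" and, for the conclusion, "`‖v^{(ν_n)} - u‖_{H^{β'}} ≤
‖v^{(ν_n)} - v_n‖_{H^{β'}} + |T³|^{1/2} ‖u - v_n‖_{C^{β'}}`" with (2.15) (`‖u - v_n‖_{C^{β'}}` small
for `a` large), `0 < β' < β̄/2`.

*Transcription* (unit torus; the mollification parameter `λ_n` is a real `λ ≥ Λ₀`; the printed
viscosity reads both `λ_n^{-1}` and, in the stress, `λ_n^{-2}` — any `0 < ν ≤ λ^{-1}` is admitted,
the dissipative part `-ν (∇v + ∇vᵀ)` of the stress being then `O(λ^{-β̄})` in `C⁰`): for `T > 0`,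
`0 < β̄ ≤ 1`, `u : ℝ → T³ → ℝ³` with `u ∈ C^{β̄}([-2T,2T] × T³)` (the accepted `HolderOnSpaceTime`,
through the shift `t ↦ u (t - 2T)` as in `BuckmasterVicol2019_thm13`), a weak Euler solution on
`(-2T, 2T)` of zero mean, and `0 < β' < β̄/2`: there is `C ≥ 1` (depending on `u`, `T`, `β̄`, `β'`)
such that for every `η > 0` there is `Λ₀ ≥ 1` such that for all `λ ≥ Λ₀` and `0 < ν ≤ λ^{-1}` some
classical Navier–Stokes–Reynolds triple `(v, p, R)` on `[0,T] × T³` with viscosity `ν`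
(`Torus.IsNSReynoldsOn`) has `v` of zero mean and satisfies the sup-norm bounds behind
(2.12)–(2.14): `‖v‖_{C⁰} ≤ C`, `‖∂ᵢ v‖_{C⁰}, ‖∂ₜ v‖_{C⁰} ≤ C λ`, `‖R‖_{C⁰} ≤ C λ^{-β̄}`,
`‖∂ᵢ R‖_{C⁰}, ‖∂ₜ R‖_{C⁰} ≤ C λ` (one-sided `∂ₜ` within `[0,T]`), together with the two `H^{β'}`
statements the proof uses: `sup_{t ∈ [0,T]} ‖v(t) - u(t)‖_{H^{β'}} ≤ η` (from (2.15): mollification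
converges in `C^{β''}` for `β'' < β̄`, and `C^{β''} ⊂ H^{β'}` for `β' < β''`; the printed
`|T³|^{1/2} ‖·‖_{C^{β'}}` bound of the `H^{β'}` norm needs `β'' > β'`, whence the room `β' < β̄/2`)
and `sup_{t ∈ [0,T]} ‖v(t)‖_{H^{β'}} ≤ C` ("uniformly bounded", Thm. 1.3; mollification does not
increase Hölder norms). `H^{β'}` norms are the spectral `Torus.eSobolevNorm` of the complexified
field. The restriction `β̄ ≤ 1` loses nothing (`C^{β̄} ⊂ C^{1}` on the compact space–time slab, used
in the assembly). The proof (space–time mollification, the mollified Euler equation and its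
pressure, the Constantin–E–Titi commutator estimate, Hölder–Sobolev embedding on `T³`) is not
formalised here. [cite: BuckmasterVicol2019Annals, §2.5 (2.12)–(2.15)] -/
def BuckmasterVicol2019_mollifiedEulerStart : Prop :=
  ∀ (T : ℝ), 0 < T → ∀ (βb : ℝ≥0), 0 < βb → βb ≤ 1 →
  ∀ (u : ℝ → 𝕋³ → ℝ³),
    HolderOnSpaceTime βb (4 * T) (fun t => u (t - 2 * T)) →
    Torus.IsWeakEulerSolutionOn (4 * T) (fun t => u (t - 2 * T)) →
    (∀ t, Torus.HasZeroMean (u t)) →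
  ∀ β' : ℝ, 0 < β' → β' < βb / 2 →
  ∃ C : ℝ, 1 ≤ C ∧ ∀ η : ℝ, 0 < η → ∃ Λ₀ : ℝ, 1 ≤ Λ₀ ∧ ∀ lam : ℝ, Λ₀ ≤ lam →
  ∀ ν : ℝ, 0 < ν → ν ≤ lam⁻¹ →
  ∃ (v : ℝ → 𝕋³ → ℝ³) (p : ℝ → 𝕋³ → ℝ) (R : ℝ → 𝕋³ → Fin 3 → ℝ³),
    Torus.IsNSReynoldsOn (Icc 0 T) ν v p R ∧
    (∀ t ∈ Icc 0 T, Torus.HasZeroMean (v t)) ∧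
    BDSV.SupLE T v C ∧ BDSV.DerivSupLE T v (C * lam) ∧ BV2019.TimeDerivSupLE T v (C * lam) ∧
    BDSV.SupLE T R (C * lam ^ (-(βb : ℝ))) ∧ BDSV.DerivSupLE T R (C * lam) ∧
    BV2019.TimeDerivSupLE T R (C * lam) ∧
    (∀ t ∈ Icc 0 T, Torus.eSobolevNorm β' (EuclideanSpace.complexify ∘ (v t - u t)) ≤
      ENNReal.ofReal η) ∧
    (∀ t ∈ Icc 0 T, Torus.eSobolevNorm β' (EuclideanSpace.complexify ∘ v t) ≤ ENNReal.ofReal C)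


/-! ## Auxiliary lemmas for the assembly -/

section Aux

/-- On a set of finite diameter, an `r`-Hölder map is `s`-Hölder for `s ≤ r`
(`d^r = d^{r-s} d^s ≤ D^{r-s} d^s`). [folklore] -/
theorem HolderOnWith.of_le_of_ediam_ne_top {X Y : Type*} [PseudoEMetricSpace X]
    [PseudoEMetricSpace Y] {C r s : ℝ≥0} {f : X → Y} {A : Set X} (hf : HolderOnWith C r f A)
    (hsr : s ≤ r) (hA : Metric.ediam A ≠ ∞) :
    HolderOnWith (C * (Metric.ediam A ^ ((r : ℝ) - s)).toNNReal) s f A := by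
  intro x hx y hy
  have hD : edist x y ≤ Metric.ediam A := Metric.edist_le_ediam_of_mem hx hy
  have hrs : (0 : ℝ) ≤ (r : ℝ) - s := by
    have : (s : ℝ) ≤ r := by exact_mod_cast hsr
    linarith
  have hne : Metric.ediam A ^ ((r : ℝ) - s) ≠ ∞ := ENNReal.rpow_ne_top_of_nonneg hrs hA
  calc edist (f x) (f y) ≤ C * edist x y ^ (r : ℝ) := hf x hx y hy
    _ = C * (edist x y ^ ((r : ℝ) - s) * edist x y ^ (s : ℝ)) := by
        rw [← ENNReal.rpow_add_of_nonneg _ _ hrs (by positivity)]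
        congr 2
        ring
    _ ≤ C * (Metric.ediam A ^ ((r : ℝ) - s) * edist x y ^ (s : ℝ)) := by
        gcongr
    _ = ((C * (Metric.ediam A ^ ((r : ℝ) - s)).toNNReal : ℝ≥0) : ℝ≥0∞) * edist x y ^ (s : ℝ) := by
        rw [ENNReal.coe_mul, ENNReal.coe_toNNReal hne, mul_assoc]

/-- Space–time Hölder regularity on the slab `[0,T] × T³` can be lowered: `C^r ⊂ C^s` for
`s ≤ r` (the slab has finite diameter). [folklore] -/
theorem holderOnSpaceTime_of_le {r s : ℝ≥0} {T : ℝ} {u : ℝ → 𝕋³ → ℝ³}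
    (hu : HolderOnSpaceTime r T u) (hsr : s ≤ r) : HolderOnSpaceTime s T u := by
  obtain ⟨C, hC⟩ := hu
  have hb : Bornology.IsBounded (Icc (0 : ℝ) T ×ˢ (univ : Set 𝕋³)) :=
    (Metric.isBounded_Icc 0 T).prod (Bornology.isBounded_univ.2 inferInstance)
  exact ⟨_, HolderOnWith.of_le_of_ediam_ne_top hC hsr (Metric.isBounded_iff_ediam_ne_top.1 hb)⟩

/-- The weak Navier–Stokes property on `T³ × (0,T)` only depends on the field at times in
`(0,T)`. [folklore] -/
theorem isWeakNSSolutionOn_congr {T ν : ℝ} {w w' : ℝ → 𝕋³ → ℝ³}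
    (heq : ∀ t ∈ Ioo 0 T, w' t = w t) (hw : Torus.IsWeakNSSolutionOn T ν w) :
    Torus.IsWeakNSSolutionOn T ν w' := by
  obtain ⟨h1, h2, h3, h4⟩ := hw
  have hae : ∀ᵐ p : ℝ × EuclideanSpace ℝ (Fin 3) ∂(volume.restrict (Ioo 0 T ×ˢ univ)),
      Torus.stLift w p = Torus.stLift w' p := by
    filter_upwards [ae_restrict_mem (measurableSet_Ioo.prod MeasurableSet.univ)] with p hp
    rw [Torus.stLift, Torus.stLift, heq p.1 (mem_prod.1 hp).1]
  refine ⟨h1.congr hae, ?_, ?_, ?_⟩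
  · have h : ∫⁻ t in Ioo 0 T, ∫⁻ x, ‖w' t x‖ₑ ^ 2 = ∫⁻ t in Ioo 0 T, ∫⁻ x, ‖w t x‖ₑ ^ 2 :=
      setLIntegral_congr_fun measurableSet_Ioo (fun t ht => by rw [heq t ht])
    rw [h]
    exact h2
  · filter_upwards [h3, ae_restrict_mem measurableSet_Ioo] with t ht hmem
    rwa [heq t hmem]
  · intro ψ hψ hdiv
    have h : ∫ t in Ioo 0 T, ∫ x, (⟪w' t x, Torus.timeDeriv ψ t x⟫_ℝ +
        ⟪w' t x, Torus.convect (w' t) (ψ t) x⟫_ℝ + ν * ⟪w' t x, Torus.laplacian (ψ t) x⟫_ℝ) =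
        ∫ t in Ioo 0 T, ∫ x, (⟪w t x, Torus.timeDeriv ψ t x⟫_ℝ +
        ⟪w t x, Torus.convect (w t) (ψ t) x⟫_ℝ + ν * ⟪w t x, Torus.laplacian (ψ t) x⟫_ℝ) :=
      setIntegral_congr_fun measurableSet_Ioo (fun t ht => by rw [heq t ht])
    rw [h]
    exact h4 ψ hψ hdiv

/-- Continuity in `H^s` on a time set only depends on the field on that set. [folklore] -/
theorem continuousInSobolevOn_congr {S : Set ℝ} {s : ℝ}
    {v v' : ℝ → 𝕋³ → EuclideanSpace ℂ (Fin 3)} (heq : ∀ t ∈ S, v' t = v t)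
    (hv : Torus.ContinuousInSobolevOn S s v) : Torus.ContinuousInSobolevOn S s v' := by
  refine ⟨fun t ht => by rw [heq t ht]; exact hv.1 t ht, fun t₀ ht₀ => ?_⟩
  refine (hv.2 t₀ ht₀).congr' ?_
  filter_upwards [eventually_mem_nhdsWithin] with t ht
  rw [heq t ht, heq t₀ ht₀]

/-- Complexification commutes with subtraction of fields. [folklore] -/
theorem complexify_comp_sub (f g : 𝕋³ → ℝ³) :
    EuclideanSpace.complexify ∘ (f - g) =
      EuclideanSpace.complexify ∘ f - EuclideanSpace.complexify ∘ g := by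
  funext x
  simp [map_sub]

/-- Integrable real fields have integrable complexifications. [folklore] -/
theorem integrable_complexify_comp {f : 𝕋³ → ℝ³} (hf : Integrable f volume) :
    Integrable (EuclideanSpace.complexify ∘ f) volume :=
  ContinuousLinearMap.integrable_comp
    (EuclideanSpace.complexify (ι := Fin 3)).toContinuousLinearMap hf

/-- `‖g‖_{L²} ≤ ‖g‖_{H^s}` for `s ≥ 0` (Parseval, `Torus.eSobolevNorm_zero_eq_eLpNorm_holds`, and
monotonicity of the Sobolev scale), for a real field fed to the spectral norm through its
complexification. [folklore] -/
theorem eLpNorm_two_le_eSobolevNorm {s : ℝ} (hs : 0 ≤ s) {g : 𝕋³ → ℝ³}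
    (hg : Integrable (EuclideanSpace.complexify ∘ g) volume) :
    eLpNorm g 2 volume ≤ Torus.eSobolevNorm s (EuclideanSpace.complexify ∘ g) := by
  have h1 : eLpNorm g 2 volume = eLpNorm (EuclideanSpace.complexify ∘ g) 2 volume :=
    eLpNorm_congr_norm_ae (Eventually.of_forall fun x => by simp)
  rw [h1, ← Torus.eSobolevNorm_zero_eq_eLpNorm_holds hg]
  exact Torus.eSobolevNorm_mono hs _

/-- A time slice, inside `[0,T]`, of a field that is space–time Hölder on `[-2T,2T] × T³` (through
the shift `t ↦ u (t - 2T)` on `[0,4T]`) is continuous. [folklore] -/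
theorem continuous_slice_of_holderOnSpaceTime_shift {r : ℝ≥0} (hr : 0 < r) {T : ℝ} (hT : 0 < T)
    {u : ℝ → 𝕋³ → ℝ³} (hu : HolderOnSpaceTime r (4 * T) (fun t => u (t - 2 * T))) {t : ℝ}
    (ht : t ∈ Icc 0 T) : Continuous (u t) := by
  have hmem : t + 2 * T ∈ Icc 0 (4 * T) := ⟨by linarith [ht.1], by linarith [ht.2]⟩
  obtain ⟨C, hC⟩ := hu.memHolder hmem
  have h : t + 2 * T - 2 * T = t := by ring
  simp only [h] at hC
  exact hC.continuous hr

end Aux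

/-! ## Parameter bookkeeping (BV19 §2.4–§2.5: the choice of `a`) -/

section Parameters

open BV2019

/-- `λ_{q+1} = λ_q^b`. [folklore] -/
theorem BV2019.freq_succ (a b q : ℕ) : freq a b (q + 1) = freq a b q ^ b := by
  rw [freq, freq, pow_succ, pow_mul]

/-- `a ≤ λ_q` for `b ≥ 1`. [folklore] -/
theorem BV2019.le_freq (a : ℕ) {b : ℕ} (hb : 1 ≤ b) (q : ℕ) : a ≤ freq a b q :=
  Nat.le_self_pow (pow_ne_zero _ (by omega)) a

/-- `λ_q` as a real power: `(λ_q : ℝ) = (a : ℝ)^{b^q}`. [folklore] -/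
theorem BV2019.freq_real (a b q : ℕ) : (freq a b q : ℝ) = (a : ℝ) ^ ((b ^ q : ℕ) : ℝ) := by
  rw [freq, Nat.cast_pow, Real.rpow_natCast]

/-- `b^{m} + q ≤ b^{m+q}` for `b ≥ 2`. [folklore] -/
theorem pow_add_le_pow_add {b : ℕ} (hb : 2 ≤ b) (m q : ℕ) : b ^ m + q ≤ b ^ (m + q) := by
  have h1 : 1 ≤ b ^ m := Nat.one_le_pow _ _ (by omega)
  have h2 : q + 1 ≤ b ^ q := Nat.lt_pow_self (by omega)
  calc b ^ m + q ≤ b ^ m + b ^ m * q := by nlinarith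
    _ ≤ b ^ m * b ^ q := by nlinarith
    _ = b ^ (m + q) := (pow_add _ _ _).symm

/-- **The tail of (2.9) is small for `a` large** (BV19 §2.5 (2.11)): with `r = a^{-γ} ≤ 1/2`,
`γ = β(1-β') - 4β' > 0`, `K ∑_{q ≥ n} δ_{q+1}^{(1-β')/2} λ_{q+1}^{4β'} = K λ_1^{3β(1-β')/2} ∑_{q ≥ n} λ_{q+1}^{-γ}
≤ 2K a^{2bβ} a^{-γ b²}` for `n ≥ 1` (geometric domination through `b^{n+1+q} ≥ b^{n+1} + q`). [cite: BuckmasterVicol2019Annals, §2.5 (2.11)] -/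
theorem BV2019.tail_le {a b n : ℕ} (ha : 2 ≤ a) (hb : 2 ≤ b) (hn : 1 ≤ n) {β β' K γ : ℝ}
    (hβ : 0 < β) (hβ'0 : 0 ≤ β') (hK : 0 ≤ K) (hγ : γ = β * (1 - β') - 4 * β')
    (hγ0 : 0 ≤ γ) (hr : (a : ℝ) ^ (-γ) ≤ 1 / 2) :
    ENNReal.ofReal K * ∑' q : ℕ, ENNReal.ofReal
        (amp β a b (n + 1 + q) ^ ((1 - β') / 2) * (freq a b (n + 1 + q) : ℝ) ^ (4 * β')) ≤
      ENNReal.ofReal (2 * K * ((a : ℝ) ^ (2 * b * β) * (a : ℝ) ^ (-(γ * (b : ℝ) ^ 2)))) := by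
  have ha0 : (0 : ℝ) < a := by exact_mod_cast (lt_of_lt_of_le two_pos ha)
  have ha1 : (1 : ℝ) ≤ a := by exact_mod_cast (le_trans one_le_two ha)
  have ha1' : 1 ≤ a := le_trans one_le_two ha
  set r : ℝ := (a : ℝ) ^ (-γ) with hr_def
  have hr0 : 0 ≤ r := Real.rpow_nonneg ha0.le _
  have hr1 : r ≤ 1 := hr.trans (by norm_num)
  set L : ℝ := (freq a b 1 : ℝ) ^ (3 * β * ((1 - β') / 2)) with hL_def
  have hL0 : 0 ≤ L := Real.rpow_nonneg (Nat.cast_nonneg _) _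
  -- termwise identity
  have hpow : ∀ m : ℕ, (freq a b m : ℝ) ^ (-γ) = r ^ (b ^ m) := by
    intro m
    rw [freq_real, ← Real.rpow_mul ha0.le, mul_comm, Real.rpow_mul_natCast ha0.le]
  have hterm : ∀ m : ℕ, amp β a b m ^ ((1 - β') / 2) * (freq a b m : ℝ) ^ (4 * β') =
      L * r ^ (b ^ m) := by
    intro m
    have h1 : (0 : ℝ) ≤ (freq a b 1 : ℝ) := Nat.cast_nonneg _
    have hm : (0 : ℝ) < (freq a b m : ℝ) := freq_real_pos ha1' b m
    rw [← hpow m, hL_def, amp, Real.mul_rpow (Real.rpow_nonneg h1 _) (Real.rpow_nonneg hm.le _),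
      ← Real.rpow_mul h1, ← Real.rpow_mul hm.le, mul_assoc, ← Real.rpow_add hm]
    congr 2
    rw [hγ]; ring
  have hle : ∀ q : ℕ, L * r ^ (b ^ (n + 1 + q)) ≤ L * r ^ (b ^ (n + 1)) * r ^ q := by
    intro q
    rw [mul_assoc, ← pow_add]
    exact mul_le_mul_of_nonneg_left (pow_le_pow_of_le_one hr0 hr1 (pow_add_le_pow_add hb _ _)) hL0
  -- the geometric sum
  have hgeom : ∑' q : ℕ, ENNReal.ofReal r ^ q ≤ 2 := by
    rw [ENNReal.tsum_geometric]
    have h2 : ENNReal.ofReal r ≤ 2⁻¹ := by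
      calc ENNReal.ofReal r ≤ ENNReal.ofReal (1 / 2) := ENNReal.ofReal_le_ofReal hr
        _ = 2⁻¹ := by rw [one_div, ENNReal.ofReal_inv_of_pos two_pos, ENNReal.ofReal_ofNat]
    have h3 : (2 : ℝ≥0∞)⁻¹ ≤ 1 - ENNReal.ofReal r := by
      calc (2 : ℝ≥0∞)⁻¹ = 1 - 2⁻¹ := ENNReal.one_sub_inv_two.symm
        _ ≤ 1 - ENNReal.ofReal r := tsub_le_tsub_left h2 1
    calc (1 - ENNReal.ofReal r)⁻¹ ≤ (2⁻¹ : ℝ≥0∞)⁻¹ := ENNReal.inv_le_inv.2 h3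
      _ = 2 := inv_inv 2
  -- bounds on `L` and `r^{b^{n+1}}`
  have hL : L ≤ (a : ℝ) ^ (2 * b * β) := by
    rw [hL_def, freq_real, ← Real.rpow_mul ha0.le, pow_one]
    refine Real.rpow_le_rpow_of_exponent_le ha1 ?_
    have hb0 : (0 : ℝ) ≤ b := Nat.cast_nonneg _
    nlinarith [mul_nonneg hb0 hβ.le, mul_nonneg (mul_nonneg hb0 hβ.le) hβ'0]
  have hrb : r ^ (b ^ (n + 1)) ≤ (a : ℝ) ^ (-(γ * (b : ℝ) ^ 2)) := by
    rw [hr_def, ← Real.rpow_mul_natCast ha0.le]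
    refine Real.rpow_le_rpow_of_exponent_le ha1 ?_
    have hbb : ((b ^ 2 : ℕ) : ℝ) ≤ ((b ^ (n + 1) : ℕ) : ℝ) := by
      exact_mod_cast Nat.pow_le_pow_right (by omega) (by omega)
    push_cast at hbb ⊢
    nlinarith
  -- assemble
  calc ENNReal.ofReal K * ∑' q : ℕ, ENNReal.ofReal
          (amp β a b (n + 1 + q) ^ ((1 - β') / 2) * (freq a b (n + 1 + q) : ℝ) ^ (4 * β'))
      = ENNReal.ofReal K * ∑' q : ℕ, ENNReal.ofReal (L * r ^ (b ^ (n + 1 + q))) := by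
        simp_rw [hterm]
    _ ≤ ENNReal.ofReal K * ∑' q : ℕ, ENNReal.ofReal (L * r ^ (b ^ (n + 1))) * ENNReal.ofReal r ^ q := by
        gcongr with q
        rw [← ENNReal.ofReal_pow hr0, ← ENNReal.ofReal_mul (mul_nonneg hL0 (pow_nonneg hr0 _))]
        exact ENNReal.ofReal_le_ofReal (hle q)
    _ = ENNReal.ofReal K * (ENNReal.ofReal (L * r ^ (b ^ (n + 1))) * ∑' q : ℕ, ENNReal.ofReal r ^ q) := by
        rw [ENNReal.tsum_mul_left]
    _ ≤ ENNReal.ofReal K * (ENNReal.ofReal ((a : ℝ) ^ (2 * b * β) * (a : ℝ) ^ (-(γ * (b : ℝ) ^ 2))) * 2) := by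
        gcongr
    _ = ENNReal.ofReal (2 * K * ((a : ℝ) ^ (2 * b * β) * (a : ℝ) ^ (-(γ * (b : ℝ) ^ 2)))) := by
        rw [← ENNReal.ofReal_ofNat 2, ← ENNReal.ofReal_mul (by positivity), ← ENNReal.ofReal_mul hK]
        congr 1
        ring

end Parameters

/-! ## The assembly: Thm. 1.3 from the two named facts (BV19 §2.5) -/

section Assembly

open BV2019

/-- **The inductive estimates (2.3)–(2.5) at level `n` for the mollified start** (BV19 §2.5:
"with `a` sufficiently large, depending on `M_u` and `β̄`, we may ensure the pair `(v_n, R̊_n)` obey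
the inductive assumptions (2.3)–(2.5) for `q = n`"): the key inequality for (2.4),
`C λ^{-β̄} ≤ λ^{-ε_R} δ_{n+1} = λ^{-ε_R} λ_1^{3β} λ^{-2βb}`, valid once `ε_R + 2βb ≤ β̄/2` and
`λ^{β̄/2} ≥ C`. [cite: BuckmasterVicol2019Annals, §2.5] -/
theorem BV2019.stress_l1_key {a b n : ℕ} (ha : 1 ≤ a) {β βb εR C : ℝ} (hβ : 0 ≤ β) (hβb : 0 < βb)
    (hC : 1 ≤ C) (hεR : εR ≤ βb / 4) (hβb3 : β * b ≤ βb / 8)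
    (hCa : C ^ (2 / βb) ≤ (freq a b n : ℝ)) :
    C * (freq a b n : ℝ) ^ (-βb) ≤ (freq a b n : ℝ) ^ (-εR) * amp β a b (n + 1) := by
  set lam : ℝ := (freq a b n : ℝ) with hlam
  have hlam0 : 0 < lam := freq_real_pos ha b n
  have hlam1 : 1 ≤ lam := one_le_freq_real ha b n
  have hC0 : 0 ≤ C := zero_le_one.trans hC
  -- `δ_{n+1} ≥ λ^{-2βb}`
  have hamp : lam ^ (-(2 * β * b)) ≤ amp β a b (n + 1) := by
    have h1 : (1 : ℝ) ≤ (freq a b 1 : ℝ) ^ (3 * β) :=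
      Real.one_le_rpow (one_le_freq_real ha b 1) (by positivity)
    have h2 : (freq a b (n + 1) : ℝ) ^ (-2 * β) = lam ^ (-(2 * β * b)) := by
      rw [freq_succ, Nat.cast_pow, ← hlam, ← Real.rpow_natCast_mul hlam0.le]
      congr 1
      ring
    unfold amp
    rw [h2]
    exact le_mul_of_one_le_left (Real.rpow_nonneg hlam0.le _) h1
  -- `C ≤ λ^κ`, `κ = β̄ - ε_R - 2βb ≥ β̄/2`
  set κ : ℝ := βb - εR - 2 * β * b with hκ
  have hκ2 : βb / 2 ≤ κ := by rw [hκ]; linarith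
  have hCκ : C ≤ lam ^ κ := by
    calc C = (C ^ (2 / βb)) ^ (βb / 2) := by
            rw [← Real.rpow_mul hC0]
            have : 2 / βb * (βb / 2) = 1 := by field_simp
            rw [this, Real.rpow_one]
      _ ≤ lam ^ (βb / 2) := Real.rpow_le_rpow (Real.rpow_nonneg hC0 _) hCa (by positivity)
      _ ≤ lam ^ κ := Real.rpow_le_rpow_of_exponent_le hlam1 hκ2
  have hsplit : lam ^ (-βb) = lam ^ (-κ) * lam ^ (-(εR + 2 * β * b)) := by
    rw [← Real.rpow_add hlam0]
    congr 1
    rw [hκ]; ring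
  have hsplit' : lam ^ (-εR) * lam ^ (-(2 * β * b)) = lam ^ (-(εR + 2 * β * b)) := by
    rw [← Real.rpow_add hlam0]
    congr 1
    ring
  have hCneg : C * lam ^ (-κ) ≤ 1 := by
    rw [Real.rpow_neg hlam0.le, ← div_eq_mul_inv, div_le_one (Real.rpow_pos_of_pos hlam0 _)]
    exact hCκ
  calc C * lam ^ (-βb) = C * lam ^ (-κ) * lam ^ (-(εR + 2 * β * b)) := by rw [hsplit]; ring
    _ ≤ 1 * lam ^ (-(εR + 2 * β * b)) :=
        mul_le_mul_of_nonneg_right hCneg (Real.rpow_nonneg hlam0.le _)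
    _ = lam ^ (-εR) * lam ^ (-(2 * β * b)) := by rw [one_mul, hsplit']
    _ ≤ lam ^ (-εR) * amp β a b (n + 1) :=
        mul_le_mul_of_nonneg_left hamp (Real.rpow_nonneg hlam0.le _)

/-- `C + 3Cλ + Cλ ≤ λ^k` for `k ≥ 2`, `λ ≥ 5C ≥ 5`. [folklore] -/
theorem BV2019.c1_budget {C lam : ℝ} (hC : 1 ≤ C) (h5 : 5 * C ≤ lam) {k : ℕ} (hk : 2 ≤ k) :
    C + 3 * (C * lam) + C * lam ≤ lam ^ k := by
  have hlam1 : 1 ≤ lam := by linarith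
  have h1 : C ≤ C * lam := le_mul_of_one_le_right (by linarith) hlam1
  have h2 : 5 * C * lam ≤ lam * lam := mul_le_mul_of_nonneg_right h5 (by linarith)
  have h3 : lam ^ 2 ≤ lam ^ k := pow_le_pow_right₀ hlam1 hk
  nlinarith

/-- **Buckmaster–Vicol 2019, Thm. 1.3, from the two named facts** — the assembly of §2.5, proved.
Given `β̄ > 0`, `T > 0` and a zero-mean weak Euler solution `u ∈ C^{β̄}([-2T,2T] × T³)`:
lower `β̄` to `β̄ ∧ 1` (`holderOnSpaceTime_of_le`); fix `b = 16(b₀+1)`,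
`β = min(4/b², 1/(40b), β̄/(8b))`, `ε_R = min(ε₀, β̄/4)`, `β' = min(β̄/4, β/32)` and the constants
`K, a₀` of `BuckmasterVicol2019_iterationFromLevel`, `C` of `BuckmasterVicol2019_mollifiedEulerStart`;
for each level `n ≥ 1` choose `a = N_Λ · max(A, a₀)` with `A` so large that, with `λ_n = a^{(b^n)}`
and `ν_n = λ_n^{-1}`, the mollified triple at scale `λ_n` is `(2n)⁻¹`-close to `u` in
`C⁰_t H^{β'}`, obeys (2.3)–(2.5) at level `n` (`BV2019.c1_budget`, `BV2019.stress_l1_key`), and the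
tail of (2.9) is `≤ (2n)⁻¹` (`BV2019.tail_le`); the iteration fact then gives a weak solution
`w_n`, and `‖w_n - u‖_{C⁰_t H^{β'}} ≤ 1/n` by the triangle inequality
(`Torus.eSobolevNorm_add_le_holds`), `‖w_n‖_{C⁰_t H^{β'}} ≤ 1 + C`; extend `w_n` by zero off
`[0,T]`; finally `C⁰_t L²` convergence follows from `‖·‖_{L²} ≤ ‖·‖_{H^{β'}}` (Parseval,
`Torus.eSobolevNorm_zero_eq_eLpNorm_holds`) and `ν_n ≤ 1/n → 0`. [cite: BuckmasterVicol2019Annals, §2.5 (proof of Thm. 1.3)] -/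
theorem BuckmasterVicol2019_thm13_of_parts (hIter : BuckmasterVicol2019_iterationFromLevel)
    (hStart : BuckmasterVicol2019_mollifiedEulerStart) : BuckmasterVicol2019_thm13 := by
  intro T hT βbar hβbar u hHolder hEuler hmean
  -- Step 0: lower the Hölder exponent to `β̄ ∧ 1`
  set βb : ℝ≥0 := min βbar 1 with hβb_def
  have hβb0 : 0 < βb := lt_min hβbar one_pos
  have hβb1 : βb ≤ 1 := min_le_right _ _
  have hβbR0 : (0 : ℝ) < βb := by exact_mod_cast hβb0
  have hβbR1 : (βb : ℝ) ≤ 1 := by exact_mod_cast hβb1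
  have hHolder' : HolderOnSpaceTime βb (4 * T) (fun t => u (t - 2 * T)) :=
    holderOnSpaceTime_of_le hHolder (min_le_left _ _)
  -- Step 1: the parameters of the scheme
  obtain ⟨b₀, hb₀⟩ := hIter
  obtain ⟨b, hbb₀, hb16, hb16'⟩ : ∃ b : ℕ, b₀ ≤ b ∧ 16 ∣ b ∧ 16 ≤ b :=
    ⟨16 * (b₀ + 1), by omega, dvd_mul_right 16 _, by omega⟩
  have hb2 : 2 ≤ b := by omega
  have hbR : (16 : ℝ) ≤ b := by exact_mod_cast hb16'
  have hbR0 : (0 : ℝ) < b := by linarith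
  set β : ℝ := min (min (4 / (b : ℝ) ^ 2) (1 / (40 * b))) ((βb : ℝ) / (8 * b)) with hβ_def
  have hβ0 : 0 < β := lt_min (lt_min (by positivity) (by positivity)) (by positivity)
  have hβ1 : β * (b : ℝ) ^ 2 ≤ 4 := by
    have h : β ≤ 4 / (b : ℝ) ^ 2 := (min_le_left _ _).trans (min_le_left _ _)
    rwa [le_div_iff₀ (by positivity)] at h
  have hβ2 : β * b ≤ 1 / 40 := by
    have h : β ≤ 1 / (40 * b) := (min_le_left _ _).trans (min_le_right _ _)
    rw [le_div_iff₀ (by positivity)] at h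
    linarith
  have hβ3 : β * b ≤ βb / 8 := by
    have h : β ≤ (βb : ℝ) / (8 * b) := min_le_right _ _
    rw [le_div_iff₀ (by positivity)] at h
    linarith
  have hβ4 : β ≤ 1 := by nlinarith
  obtain ⟨ε₀, hε₀, hε⟩ := hb₀ b hbb₀ hb16 β hβ0 hβ1 hβ2
  set εR : ℝ := min ε₀ ((βb : ℝ) / 4) with hεR_def
  have hεR0 : 0 < εR := lt_min hε₀ (by positivity)
  obtain ⟨NΛ, hNΛ, hN⟩ := hε εR hεR0 (min_le_left _ _)
  set β' : ℝ := min ((βb : ℝ) / 4) (β / 32) with hβ'_def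
  have hβ'0 : 0 < β' := lt_min (by positivity) (by positivity)
  have hβ'1 : β' < βb / 2 := lt_of_le_of_lt (min_le_left _ _) (by linarith)
  have hβ'3 : β' ≤ β / 32 := min_le_right _ _
  have hβ'2 : β' < β / (8 + β) := by
    rw [lt_div_iff₀ (by positivity)]
    nlinarith
  have hβ'4 : β' ≤ 1 / 4 := (min_le_left _ _).trans (by linarith)
  obtain ⟨K, hK, a₀, hA⟩ := hN T hT β' hβ'0 hβ'2
  -- Step 2: the start data
  obtain ⟨C, hC1, hC⟩ := hStart T hT βb hβb0 hβb1 u hHolder' hEuler hmean β' hβ'0 hβ'1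
  have hC0 : 0 ≤ C := zero_le_one.trans hC1
  -- the exponents of the tail
  set γ : ℝ := β * (1 - β') - 4 * β' with hγ_def
  have hγ1 : 5 / 8 * β ≤ γ := by rw [hγ_def]; nlinarith
  have hγ0 : 0 < γ := by linarith
  set μ : ℝ := γ * (b : ℝ) ^ 2 - 2 * b * β with hμ_def
  have hμ0 : 0 < μ := by
    rw [hμ_def]
    nlinarith [mul_nonneg (sub_nonneg.2 hbR) (mul_pos hbR0 hβ0).le, mul_pos hbR0 hβ0]
  -- Step 3: at every level `n ≥ 1`, a weak solution within `1/n` of `u`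
  have step : ∀ n : ℕ, 1 ≤ n → ∃ (ν : ℝ) (W : ℝ → 𝕋³ → ℝ³), 0 < ν ∧ ν ≤ 1 / n ∧
      Torus.IsWeakNSSolutionOn T ν W ∧ (∀ t, Torus.HasZeroMean (W t)) ∧
      Torus.ContinuousInSobolevOn (Icc 0 T) β' (fun t => EuclideanSpace.complexify ∘ W t) ∧
      (∀ t ∈ Icc 0 T, Torus.eSobolevNorm β' (EuclideanSpace.complexify ∘ W t) ≤
        ENNReal.ofReal (1 + C)) ∧
      (∀ t ∈ Icc 0 T, Torus.eSobolevNorm β' (EuclideanSpace.complexify ∘ (W t - u t)) ≤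
        ENNReal.ofReal (1 / n)) := by
    intro n hn
    have hn0 : (0 : ℝ) < n := by exact_mod_cast hn
    obtain ⟨Λ₀, hΛ₀, hΛ⟩ := hC (1 / (2 * n)) (by positivity)
    -- requirements on `a`, all eventually true
    have hcast : Tendsto (fun a : ℕ => (a : ℝ)) atTop atTop := tendsto_natCast_atTop_atTop
    have E1 : ∀ᶠ a : ℕ in atTop, Λ₀ ≤ (a : ℝ) := hcast.eventually_ge_atTop Λ₀
    have E2 : ∀ᶠ a : ℕ in atTop, (n : ℝ) ≤ (a : ℝ) := hcast.eventually_ge_atTop _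
    have E3 : ∀ᶠ a : ℕ in atTop, 5 * C ≤ (a : ℝ) := hcast.eventually_ge_atTop _
    have E4 : ∀ᶠ a : ℕ in atTop, C ^ (2 / (βb : ℝ)) ≤ (a : ℝ) := hcast.eventually_ge_atTop _
    have E5 : ∀ᶠ a : ℕ in atTop, (a : ℝ) ^ (-γ) ≤ 1 / 2 :=
      ((tendsto_rpow_neg_atTop hγ0).comp hcast).eventually (Iic_mem_nhds (by norm_num))
    have E6 : ∀ᶠ a : ℕ in atTop,
        2 * K * ((a : ℝ) ^ (2 * b * β) * (a : ℝ) ^ (-(γ * (b : ℝ) ^ 2))) ≤ 1 / (2 * n) := by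
      have h1 : Tendsto (fun a : ℕ => 2 * K * (a : ℝ) ^ (-μ)) atTop (𝓝 0) := by
        rw [show (0 : ℝ) = 2 * K * 0 by ring]
        exact ((tendsto_rpow_neg_atTop hμ0).comp hcast).const_mul _
      have h2 : (fun a : ℕ => 2 * K * (a : ℝ) ^ (-μ)) =ᶠ[atTop]
          fun a : ℕ => 2 * K * ((a : ℝ) ^ (2 * b * β) * (a : ℝ) ^ (-(γ * (b : ℝ) ^ 2))) := by
        filter_upwards [eventually_ge_atTop 1] with a ha
        have ha0 : (0 : ℝ) < a := by exact_mod_cast ha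
        rw [← Real.rpow_add ha0]
        congr 2
        rw [hμ_def]; ring
      exact (h1.congr' h2).eventually (Iic_mem_nhds (by positivity))
    have E7 : ∀ᶠ a : ℕ in atTop, 2 ≤ a := eventually_ge_atTop 2
    obtain ⟨A, hAev⟩ : ∃ A : ℕ, ∀ a ≥ A, Λ₀ ≤ (a : ℝ) ∧ (n : ℝ) ≤ (a : ℝ) ∧ 5 * C ≤ (a : ℝ) ∧
        C ^ (2 / (βb : ℝ)) ≤ (a : ℝ) ∧ (a : ℝ) ^ (-γ) ≤ 1 / 2 ∧
        2 * K * ((a : ℝ) ^ (2 * b * β) * (a : ℝ) ^ (-(γ * (b : ℝ) ^ 2))) ≤ 1 / (2 * n) ∧ 2 ≤ a := by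
      refine eventually_atTop.1 ?_
      filter_upwards [E1, E2, E3, E4, E5, E6, E7] with a h1 h2 h3 h4 h5 h6 h7
      exact ⟨h1, h2, h3, h4, h5, h6, h7⟩
    set a : ℕ := NΛ * max A a₀ with ha_def
    have hmax : max A a₀ ≤ a := Nat.le_mul_of_pos_left _ hNΛ
    have haA : A ≤ a := (le_max_left _ _).trans hmax
    have haa₀ : a₀ ≤ a := (le_max_right _ _).trans hmax
    have hadvd : NΛ ∣ a := dvd_mul_right _ _
    obtain ⟨h_Λ, h_n, h_5C, h_C2, h_r, h_tail, h_2⟩ := hAev a haA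
    have ha1 : 1 ≤ a := le_trans one_le_two h_2
    -- `λ_n`
    set lam : ℝ := (freq a b n : ℝ) with hlam
    have ha_lam : (a : ℝ) ≤ lam := by
      rw [hlam]; exact_mod_cast le_freq a (by omega) n
    have hlam1 : 1 ≤ lam := one_le_freq_real ha1 b n
    have hlam0 : 0 < lam := freq_real_pos ha1 b n
    -- the start triple at scale `λ_n`, viscosity `ν_n = λ_n^{-1}`
    set ν : ℝ := lam⁻¹ with hν
    have hν0 : 0 < ν := inv_pos.2 hlam0
    have hν1 : ν ≤ 1 := inv_le_one_of_one_le₀ hlam1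
    have hνn : ν ≤ 1 / n := by
      rw [hν, ← one_div]
      exact one_div_le_one_div_of_le hn0 (h_n.trans ha_lam)
    obtain ⟨v, p, R, hNSR, hvmean, hv0, hv1, hv2, hR0, hR1, hR2, hclose, hbound⟩ :=
      hΛ lam (h_Λ.trans ha_lam) ν hν0 le_rfl
    -- (2.3)–(2.5) at level `n`
    have h5C : 5 * C ≤ lam := h_5C.trans ha_lam
    have h23 : C1xtLE T v (lam ^ 4) := c1xtLE_of_bounds hv0 hv1 hv2 (c1_budget hC1 h5C (by norm_num))
    have hR0' : BDSV.SupLE T R C := hR0.mono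
      (mul_le_of_le_one_right hC0 (Real.rpow_le_one_of_one_le_of_nonpos hlam1 (by linarith)))
    have h25 : C1xtLE T R (lam ^ 10) := c1xtLE_of_bounds hR0' hR1 hR2 (c1_budget hC1 h5C (by norm_num))
    have h24 : L1LE T R (lam ^ (-εR) * amp β a b (n + 1)) :=
      (l1LE_of_supLE hR0).mono (stress_l1_key ha1 hβ0.le hβbR0 hC1 (min_le_right _ _) hβ3 (h_C2.trans ha_lam))
    -- run the scheme
    obtain ⟨w, hw, hwmean, hwcont, hwclose⟩ :=
      hA a haa₀ hadvd ν hν0 hν1 n hn v p R hNSR hvmean h23 h24 h25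
    have htail : ENNReal.ofReal K * ∑' q : ℕ, ENNReal.ofReal
        (amp β a b (n + 1 + q) ^ ((1 - β') / 2) * (freq a b (n + 1 + q) : ℝ) ^ (4 * β')) ≤
        ENNReal.ofReal (1 / (2 * n)) :=
      (tail_le h_2 hb2 hn hβ0 hβ'0.le hK.le hγ_def hγ0.le h_r).trans (ENNReal.ofReal_le_ofReal h_tail)
    -- integrability of the slices
    have hint_w : ∀ t ∈ Icc 0 T, Integrable (EuclideanSpace.complexify ∘ w t) volume :=
      fun t ht => (hwcont.1 t ht).integrable
    have hint_v : ∀ t ∈ Icc 0 T, Integrable (EuclideanSpace.complexify ∘ v t) volume :=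
      fun t ht => integrable_complexify_comp
        (hNSR.smooth_velocity.isSmooth_slice ht).continuous.integrable_unitAddTorus
    have hint_u : ∀ t ∈ Icc 0 T, Integrable (EuclideanSpace.complexify ∘ u t) volume :=
      fun t ht => integrable_complexify_comp
        (continuous_slice_of_holderOnSpaceTime_shift hβb0 hT hHolder' ht).integrable_unitAddTorus
    -- extension by zero off `[0,T]`
    set W : ℝ → 𝕋³ → ℝ³ := fun t => if t ∈ Icc 0 T then w t else 0 with hW_def
    have hWeq : ∀ t ∈ Icc 0 T, W t = w t := fun t ht => if_pos ht
    refine ⟨ν, W, hν0, hνn, ?_, ?_, ?_, ?_, ?_⟩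
    · exact isWeakNSSolutionOn_congr (fun t ht => hWeq t (Ioo_subset_Icc_self ht)) hw
    · intro t
      by_cases ht : t ∈ Icc 0 T
      · rw [hWeq t ht]; exact hwmean t ht
      · have h0 : W t = 0 := if_neg ht
        rw [h0]
        simp [Torus.HasZeroMean]
    · refine continuousInSobolevOn_congr (fun t ht => ?_) hwcont
      show EuclideanSpace.complexify ∘ W t = EuclideanSpace.complexify ∘ w t
      rw [hWeq t ht]
    · intro t ht
      rw [hWeq t ht]
      have hsplit : EuclideanSpace.complexify ∘ w t =
          EuclideanSpace.complexify ∘ (w t - v t) + EuclideanSpace.complexify ∘ v t := by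
        funext x; simp
      have hint_wv : Integrable (EuclideanSpace.complexify ∘ (w t - v t)) volume := by
        rw [complexify_comp_sub]; exact (hint_w t ht).sub (hint_v t ht)
      rw [hsplit]
      refine (Torus.eSobolevNorm_add_le_holds hint_wv (hint_v t ht)).trans ?_
      calc Torus.eSobolevNorm β' (EuclideanSpace.complexify ∘ (w t - v t)) +
            Torus.eSobolevNorm β' (EuclideanSpace.complexify ∘ v t)
          ≤ ENNReal.ofReal (1 / (2 * n)) + ENNReal.ofReal C :=
            add_le_add ((hwclose t ht).trans htail) (hbound t ht)
        _ = ENNReal.ofReal (1 / (2 * n) + C) := (ENNReal.ofReal_add (by positivity) hC0).symm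
        _ ≤ ENNReal.ofReal (1 + C) := by
            refine ENNReal.ofReal_le_ofReal ?_
            have h1 : 1 / (2 * (n : ℝ)) ≤ 1 := by
              rw [div_le_one (by positivity)]
              have : (1 : ℝ) ≤ n := by exact_mod_cast hn
              linarith
            linarith
    · intro t ht
      rw [hWeq t ht]
      have hsplit : EuclideanSpace.complexify ∘ (w t - u t) =
          EuclideanSpace.complexify ∘ (w t - v t) + EuclideanSpace.complexify ∘ (v t - u t) := by
        funext x; simp
      have hint_wv : Integrable (EuclideanSpace.complexify ∘ (w t - v t)) volume := by
        rw [complexify_comp_sub]; exact (hint_w t ht).sub (hint_v t ht)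
      have hint_vu : Integrable (EuclideanSpace.complexify ∘ (v t - u t)) volume := by
        rw [complexify_comp_sub]; exact (hint_v t ht).sub (hint_u t ht)
      rw [hsplit]
      refine (Torus.eSobolevNorm_add_le_holds hint_wv hint_vu).trans ?_
      calc Torus.eSobolevNorm β' (EuclideanSpace.complexify ∘ (w t - v t)) +
            Torus.eSobolevNorm β' (EuclideanSpace.complexify ∘ (v t - u t))
          ≤ ENNReal.ofReal (1 / (2 * n)) + ENNReal.ofReal (1 / (2 * n)) :=
            add_le_add ((hwclose t ht).trans htail) (hclose t ht)
        _ = ENNReal.ofReal (1 / n) := by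
            rw [← ENNReal.ofReal_add (by positivity) (by positivity)]
            congr 1
            field_simp
            ring
  -- Step 4: the sequence `n ↦ level n+1`
  have step' : ∀ m : ℕ, ∃ (ν : ℝ) (W : ℝ → 𝕋³ → ℝ³), 0 < ν ∧ ν ≤ 1 / ((m : ℝ) + 1) ∧
      Torus.IsWeakNSSolutionOn T ν W ∧ (∀ t, Torus.HasZeroMean (W t)) ∧
      Torus.ContinuousInSobolevOn (Icc 0 T) β' (fun t => EuclideanSpace.complexify ∘ W t) ∧
      (∀ t ∈ Icc 0 T, Torus.eSobolevNorm β' (EuclideanSpace.complexify ∘ W t) ≤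
        ENNReal.ofReal (1 + C)) ∧
      (∀ t ∈ Icc 0 T, Torus.eSobolevNorm β' (EuclideanSpace.complexify ∘ (W t - u t)) ≤
        ENNReal.ofReal (1 / ((m : ℝ) + 1))) := by
    intro m
    have h := step (m + 1) (by omega)
    push_cast at h
    exact h
  choose ν W hν0 hνle hW hWmean hWcont hWbd hWclose using step'
  refine ⟨β', ν, W, hβ'0, hν0, ?_, hW, hWmean, hWcont, ⟨(1 + C).toNNReal, hWbd⟩, ?_⟩
  · exact tendsto_of_tendsto_of_tendsto_of_le_of_le tendsto_const_nhds
      tendsto_one_div_add_atTop_nhds_zero_nat (fun m => (hν0 m).le) hνle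
  · have hb : ∀ m : ℕ, (⨆ t ∈ Icc 0 T, eLpNorm (W m t - u t) 2 volume) ≤
        ENNReal.ofReal (1 / ((m : ℝ) + 1)) := by
      intro m
      refine iSup₂_le fun t ht => ?_
      refine (eLpNorm_two_le_eSobolevNorm hβ'0.le ?_).trans (hWclose m t ht)
      rw [complexify_comp_sub]
      exact ((hWcont m).1 t ht).integrable.sub (integrable_complexify_comp
        (continuous_slice_of_holderOnSpaceTime_shift hβb0 hT hHolder' ht).integrable_unitAddTorus)
    refine tendsto_of_tendsto_of_tendsto_of_le_of_le tendsto_const_nhds ?_ (fun m => zero_le) hb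
    rw [← ENNReal.ofReal_zero]
    exact ENNReal.tendsto_ofReal tendsto_one_div_add_atTop_nhds_zero_nat

end Assembly

end Literature.Barriers.AnomalousDissipation

end
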